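import Mathlib
import HarnessLib

/-!
# Weak (almost) contractions: Berinde's fixed point principle and the theorems of Kannan,
# Chatterjea and Zamfirescu

Source: V. Berinde, *Iterative Approximation of Fixed Points*, 2nd ed., Lecture Notes in
Mathematics 1912, Springer (2007) [Berinde2007], Chapter 2, §2.3 (Theorem 2.3 = Kannan's
theorem, Corollary 2.3, Theorem 2.4 = Zamfirescu's theorem and the Remark following it) and
§2.7 (weak contractions: condition (32), Propositions 2.2 and 2.3, Corollary 2.5,
Theorem 2.11, Theorem 2.12 and Remark 4 after it).

Let `(X, d)` be a metric space and `T : X → X`.  Berinde calls `T` a *weak contraction* (in the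
later literature: an *almost contraction* or a `(δ, L)`-*weak contraction*; the name is unrelated
to weak contractions of manifolds or to operators of norm `≤ 1`) if there are `δ ∈ [0, 1)` and
`L ≥ 0` with

  `d(Tx, Ty) ≤ δ · d(x, y) + L · d(y, Tx)` for all `x, y`                              (32)

(`IsAlmostContraction`).  This file proves, for the Picard iteration `xₙ = Tⁿ x₀`:

* Theorem 2.11: in a complete metric space every Picard sequence of a weak contraction
  converges to a fixed point of `T` (`IsAlmostContraction.exists_fixedPoint_tendsto_iterate`),
  with the a priori estimate (35) `d(xₙ, x*) ≤ δⁿ/(1 - δ) · d(x₀, x₁)`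
  (`IsAlmostContraction.dist_iterate_limit_le_apriori`) and the a posteriori estimate (36)
  `d(xₙ, x*) ≤ δ/(1 - δ) · d(xₙ₋₁, xₙ)` (`IsAlmostContraction.dist_iterate_limit_le_aposteriori`);
* Theorem 2.12: if moreover `d(Tx, Ty) ≤ θ · d(x, y) + L₁ · d(x, Tx)` for some `θ ∈ [0, 1)`,
  `L₁ ≥ 0` (condition (42), `BerindeUniquenessCondition`), the fixed point is unique, every Picard
  sequence converges to it, and (43) `d(xₙ₊₁, x*) ≤ θ · d(xₙ, x*)`
  (`IsAlmostContraction.existsUnique_fixedPoint`,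
  `BerindeUniquenessCondition.tendsto_iterate_fixedPoint`,
  `BerindeUniquenessCondition.dist_iterate_succ_fixedPoint_le`);
* Proposition 2.2 / Remark 4: a Kannan mapping, `d(Tx, Ty) ≤ a · [d(x, Tx) + d(y, Ty)]` with
  `a ∈ [0, 1/2)` ((8), `IsKannanMapping`), is a weak contraction with `δ = a/(1 - a)`,
  `L = 2a/(1 - a)` and satisfies (42) with the same constants; hence Kannan's theorem
  (Theorem 2.3) with the error estimates (11), (12) of Corollary 2.3
  (`IsKannanMapping.existsUnique_fixedPoint`, `….tendsto_iterate_fixedPoint`,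
  `….dist_iterate_fixedPoint_le_apriori`, `….dist_iterate_fixedPoint_le_aposteriori`);
* Proposition 2.3 / Remark 4: the same for Chatterjea mappings,
  `d(Tx, Ty) ≤ c · [d(x, Ty) + d(y, Tx)]`, `c ∈ [0, 1/2)` ((34), `IsChatterjeaMapping`);
* Corollary 2.5, Theorem 2.4 and the Remark after it: a Zamfirescu mapping (for every pair
  `x, y` at least one of (z₁) `d(Tx, Ty) ≤ α d(x, y)`, (z₂) `d(Tx, Ty) ≤ β [d(x, Tx) + d(y, Ty)]`,
  (z₃) `d(Tx, Ty) ≤ γ [d(x, Ty) + d(y, Tx)]` holds, with `α ∈ [0, 1)`, `β, γ ∈ [0, 1/2)`;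
  `IsZamfirescuMapping`) satisfies (15) `d(Tx, Ty) ≤ 2δ d(x, Tx) + δ d(x, y)` and
  (16) `d(Tx, Ty) ≤ 2δ d(x, Ty) + δ d(x, y)` with `δ = max {α, β/(1 - β), γ/(1 - γ)} < 1`
  (`IsZamfirescuMapping.dist_le_fifteen`, `….dist_le_sixteen`), hence is a weak contraction
  satisfying (42), and Zamfirescu's theorem with the estimates (11), (12) for `δ` follows
  (`IsZamfirescuMapping.existsUnique_fixedPoint`, `….tendsto_iterate_fixedPoint`,
  `….dist_iterate_fixedPoint_le_apriori`, `….dist_iterate_fixedPoint_le_aposteriori`).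

Banach's contraction principle itself is Mathlib's `ContractingWith`; we only record that a
`δ`-contraction is a weak contraction with `L = 0` (`IsAlmostContraction.of_lipschitzWith`).

Deviations from the source.  (a) The book takes `δ, θ ∈ (0, 1)`; we allow `δ, θ ∈ [0, 1)`,
which only weakens the hypotheses.  (b) The orbit lemmas are stated for an arbitrary sequence
`x : ℕ → X` with `x (n + 1) = T (x n)`, and then specialised to `T^[n] x₀`.  (c) Completeness is
assumed only where a limit has to be produced; the estimates (35), (36), (43) are proved for any
Picard sequence known to converge.
-/

open Filter Topology Function

namespace Literature.Analysis.Convex.AlmostContractions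

variable {X : Type*} [MetricSpace X]

/-! ## Weak (almost) contractions: condition (32) -/

/-- Berinde's *weak contraction* (almost contraction) condition (32):
`d(Tx, Ty) ≤ δ d(x, y) + L d(y, Tx)` for all `x, y`, with `δ ∈ [0, 1)` and `L ≥ 0`.
[cite: Berinde2007, Ch. 2 §2.7 (32)] -/
structure IsAlmostContraction (T : X → X) (δ L : ℝ) : Prop where
  nonneg : 0 ≤ δ
  lt_one : δ < 1
  coeff_nonneg : 0 ≤ L
  dist_le : ∀ x y, dist (T x) (T y) ≤ δ * dist x y + L * dist y (T x)

/-- The uniqueness condition (42): `d(Tx, Ty) ≤ θ d(x, y) + L₁ d(x, Tx)` for all `x, y`, with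
`θ ∈ [0, 1)` and `L₁ ≥ 0`.
[cite: Berinde2007, Ch. 2 Thm 2.12 (42)] -/
structure BerindeUniquenessCondition (T : X → X) (θ L₁ : ℝ) : Prop where
  nonneg : 0 ≤ θ
  lt_one : θ < 1
  coeff_nonneg : 0 ≤ L₁
  dist_le : ∀ x y, dist (T x) (T y) ≤ θ * dist x y + L₁ * dist x (T x)

namespace IsAlmostContraction

variable {T : X → X} {δ L : ℝ}

/-- The dual form (33) of (32): `d(Tx, Ty) ≤ δ d(x, y) + L d(x, Ty)`.
[cite: Berinde2007, Ch. 2 §2.7 (33)] -/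
theorem dist_le' (h : IsAlmostContraction T δ L) (x y : X) :
    dist (T x) (T y) ≤ δ * dist x y + L * dist x (T y) := by
  rw [dist_comm (T x), dist_comm x y]
  exact h.dist_le y x

/-- A `δ`-contraction (`δ < 1`) is a weak contraction with `L = 0`.
[cite: Berinde2007, Ch. 2 §2.7 (remark after (33))] -/
theorem of_lipschitzWith {K : NNReal} (hK : (K : ℝ) < 1) (hT : LipschitzWith K T) :
    IsAlmostContraction T K 0 where
  nonneg := K.coe_nonneg
  lt_one := hK
  coeff_nonneg := le_rfl
  dist_le x y := by
    rw [zero_mul, add_zero]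
    exact hT.dist_le_mul x y

section Orbit

variable {x : ℕ → X}

/-- (37): along a Picard sequence, `d(xₙ₊₁, xₙ₊₂) ≤ δ d(xₙ, xₙ₊₁)`.
[cite: Berinde2007, Ch. 2 Thm 2.11 (37)] -/
theorem orbit_dist_succ_le (h : IsAlmostContraction T δ L) (hx : ∀ n, x (n + 1) = T (x n))
    (n : ℕ) : dist (x (n + 1)) (x (n + 2)) ≤ δ * dist (x n) (x (n + 1)) := by
  have key := h.dist_le (x n) (x (n + 1))
  have h1 : x (n + 2) = T (x (n + 1)) := hx (n + 1)
  rw [← hx n, dist_self, mul_zero, add_zero, ← h1] at key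
  exact key

/-- Geometric decay of the steps: `d(xₙ, xₙ₊₁) ≤ d(x₀, x₁) · δⁿ`.
[cite: Berinde2007, Ch. 2 Thm 2.11 (proof, after (37))] -/
theorem orbit_dist_succ_le_geometric (h : IsAlmostContraction T δ L)
    (hx : ∀ n, x (n + 1) = T (x n)) (n : ℕ) :
    dist (x n) (x (n + 1)) ≤ dist (x 0) (x 1) * δ ^ n := by
  induction n with
  | zero => simp
  | succ n ih =>
    calc dist (x (n + 1)) (x (n + 1 + 1)) ≤ δ * dist (x n) (x (n + 1)) :=
          h.orbit_dist_succ_le hx n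
      _ ≤ δ * (dist (x 0) (x 1) * δ ^ n) := mul_le_mul_of_nonneg_left ih h.nonneg
      _ = dist (x 0) (x 1) * δ ^ (n + 1) := by ring

/-- A Picard sequence of a weak contraction is Cauchy ((38)).
[cite: Berinde2007, Ch. 2 Thm 2.11 (38)] -/
theorem orbit_cauchySeq (h : IsAlmostContraction T δ L) (hx : ∀ n, x (n + 1) = T (x n)) :
    CauchySeq x :=
  cauchySeq_of_le_geometric δ (dist (x 0) (x 1)) h.lt_one (h.orbit_dist_succ_le_geometric hx)

/-- (40) and the conclusion of Theorem 2.11: the limit of a convergent Picard sequence of a weak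
contraction is a fixed point.
[cite: Berinde2007, Ch. 2 Thm 2.11 (40)] -/
theorem orbit_isFixedPt_of_tendsto (h : IsAlmostContraction T δ L)
    (hx : ∀ n, x (n + 1) = T (x n)) {p : X} (hp : Tendsto x atTop (𝓝 p)) : T p = p := by
  -- (40): `d(p, Tp) ≤ (1 + L) d(p, xₙ₊₁) + δ d(xₙ, p)` for all `n`.
  have h40 : ∀ n, dist p (T p) ≤ (1 + L) * dist p (x (n + 1)) + δ * dist (x n) p := by
    intro n
    have h1 := h.dist_le (x n) p
    rw [← hx n] at h1
    calc dist p (T p) ≤ dist p (x (n + 1)) + dist (x (n + 1)) (T p) := dist_triangle _ _ _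
      _ ≤ dist p (x (n + 1)) + (δ * dist (x n) p + L * dist p (x (n + 1))) :=
          add_le_add (le_refl _) h1
      _ = (1 + L) * dist p (x (n + 1)) + δ * dist (x n) p := by ring
  have hlim : Tendsto (fun n => (1 + L) * dist p (x (n + 1)) + δ * dist (x n) p) atTop
      (𝓝 ((1 + L) * dist p p + δ * dist p p)) := by
    have h1 : Tendsto (fun n => x (n + 1)) atTop (𝓝 p) := hp.comp (tendsto_add_atTop_nat 1)
    exact ((tendsto_const_nhds.dist h1).const_mul _).add ((hp.dist tendsto_const_nhds).const_mul _)
  rw [dist_self, mul_zero, mul_zero, add_zero] at hlim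
  have h0 : dist p (T p) ≤ 0 := le_of_tendsto_of_tendsto' tendsto_const_nhds hlim h40
  exact (dist_le_zero.1 h0).symm

/-- The a priori estimate (35): `d(xₙ, x*) ≤ d(x₀, x₁) δⁿ / (1 - δ)` for the limit `x*` of the
Picard sequence.
[cite: Berinde2007, Ch. 2 Thm 2.11 (35)] -/
theorem orbit_dist_limit_le_apriori (h : IsAlmostContraction T δ L)
    (hx : ∀ n, x (n + 1) = T (x n)) {p : X} (hp : Tendsto x atTop (𝓝 p)) (n : ℕ) :
    dist (x n) p ≤ dist (x 0) (x 1) * δ ^ n / (1 - δ) :=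
  dist_le_of_le_geometric_of_tendsto δ (dist (x 0) (x 1)) h.lt_one
    (h.orbit_dist_succ_le_geometric hx) hp n

/-- The a posteriori estimate (36): `d(xₙ₊₁, x*) ≤ δ / (1 - δ) · d(xₙ, xₙ₊₁)` ((41) with
`p → ∞`).
[cite: Berinde2007, Ch. 2 Thm 2.11 (36)] -/
theorem orbit_dist_limit_le_aposteriori (h : IsAlmostContraction T δ L)
    (hx : ∀ n, x (n + 1) = T (x n)) {p : X} (hp : Tendsto x atTop (𝓝 p)) (n : ℕ) :
    dist (x (n + 1)) p ≤ δ / (1 - δ) * dist (x n) (x (n + 1)) := by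
  -- the shifted sequence `k ↦ x (n + 1 + k)` has steps bounded by `(δ d(xₙ, xₙ₊₁)) δᵏ`
  have hx' : ∀ k, x (n + 1 + (k + 1)) = T (x (n + 1 + k)) := fun k => hx (n + 1 + k)
  have hgeom : ∀ k, dist (x (n + 1 + k)) (x (n + 1 + (k + 1))) ≤
      δ * dist (x n) (x (n + 1)) * δ ^ k := by
    intro k
    have h1 := h.orbit_dist_succ_le_geometric (x := fun k => x (n + 1 + k)) hx' k
    simp only [add_zero] at h1
    calc dist (x (n + 1 + k)) (x (n + 1 + (k + 1)))
        ≤ dist (x (n + 1)) (x (n + 1 + 1)) * δ ^ k := h1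
      _ ≤ δ * dist (x n) (x (n + 1)) * δ ^ k :=
          mul_le_mul_of_nonneg_right (h.orbit_dist_succ_le hx n) (pow_nonneg h.nonneg k)
  have hp' : Tendsto (fun k => x (n + 1 + k)) atTop (𝓝 p) :=
    hp.comp (tendsto_atTop_atTop_of_monotone (fun a b hab => by omega) fun b => ⟨b, by omega⟩)
  have := dist_le_of_le_geometric_of_tendsto₀ δ (δ * dist (x n) (x (n + 1))) h.lt_one hgeom hp'
  simp only [add_zero] at this
  calc dist (x (n + 1)) p ≤ δ * dist (x n) (x (n + 1)) / (1 - δ) := this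
    _ = δ / (1 - δ) * dist (x n) (x (n + 1)) := by ring

/-- Theorem 2.11 (1), (2): in a complete metric space every Picard sequence of a weak
contraction converges to a fixed point.
[cite: Berinde2007, Ch. 2 Thm 2.11] -/
theorem orbit_exists_fixedPoint_tendsto [CompleteSpace X] (h : IsAlmostContraction T δ L)
    (hx : ∀ n, x (n + 1) = T (x n)) : ∃ p : X, T p = p ∧ Tendsto x atTop (𝓝 p) := by
  obtain ⟨p, hp⟩ := cauchySeq_tendsto_of_complete (h.orbit_cauchySeq hx)
  exact ⟨p, h.orbit_isFixedPt_of_tendsto hx hp, hp⟩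

end Orbit

/-! ### The Picard iteration `T^[n] x₀` -/

/-- `Tⁿ⁺¹ x₀ = T (Tⁿ x₀)` (Mathlib's `Function.iterate_succ_apply'`). [folklore] -/
private theorem picard_iterate_succ {Y : Type*} (T : Y → Y) (x₀ : Y) (n : ℕ) :
    T^[n + 1] x₀ = T (T^[n] x₀) :=
  iterate_succ_apply' T n x₀

/-- Theorem 2.11 (1), (2) for `xₙ = Tⁿ x₀`: the Picard iteration of a weak contraction on a
complete metric space converges to a fixed point of `T`.
[cite: Berinde2007, Ch. 2 Thm 2.11] -/
theorem exists_fixedPoint_tendsto_iterate [CompleteSpace X] (h : IsAlmostContraction T δ L)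
    (x₀ : X) : ∃ p : X, T p = p ∧ Tendsto (fun n => T^[n] x₀) atTop (𝓝 p) :=
  h.orbit_exists_fixedPoint_tendsto (picard_iterate_succ T x₀)

/-- Theorem 2.11 (1): a weak contraction on a nonempty complete metric space has a fixed point.
[cite: Berinde2007, Ch. 2 Thm 2.11 (1)] -/
theorem exists_fixedPoint [CompleteSpace X] [Nonempty X] (h : IsAlmostContraction T δ L) :
    ∃ p : X, T p = p := by
  obtain ⟨p, hp, -⟩ := h.exists_fixedPoint_tendsto_iterate (Classical.arbitrary X)
  exact ⟨p, hp⟩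

/-- The a priori estimate (35) for `xₙ = Tⁿ x₀` and its limit `x*`.
[cite: Berinde2007, Ch. 2 Thm 2.11 (35)] -/
theorem dist_iterate_limit_le_apriori (h : IsAlmostContraction T δ L) (x₀ : X) {p : X}
    (hp : Tendsto (fun n => T^[n] x₀) atTop (𝓝 p)) (n : ℕ) :
    dist (T^[n] x₀) p ≤ dist x₀ (T x₀) * δ ^ n / (1 - δ) := by
  simpa using h.orbit_dist_limit_le_apriori (picard_iterate_succ T x₀) hp n

/-- The a posteriori estimate (36) for `xₙ = Tⁿ x₀` and its limit `x*`.
[cite: Berinde2007, Ch. 2 Thm 2.11 (36)] -/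
theorem dist_iterate_limit_le_aposteriori (h : IsAlmostContraction T δ L) (x₀ : X) {p : X}
    (hp : Tendsto (fun n => T^[n] x₀) atTop (𝓝 p)) (n : ℕ) :
    dist (T^[n + 1] x₀) p ≤ δ / (1 - δ) * dist (T^[n] x₀) (T^[n + 1] x₀) :=
  h.orbit_dist_limit_le_aposteriori (picard_iterate_succ T x₀) hp n

end IsAlmostContraction

/-! ## The uniqueness condition (42) and Theorem 2.12 -/

namespace BerindeUniquenessCondition

variable {T : X → X} {θ L₁ : ℝ}

/-- The dual form (44) of (42): `d(Tx, Ty) ≤ θ d(x, y) + L₁ d(y, Ty)`.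
[cite: Berinde2007, Ch. 2 Thm 2.12 Remark 1 (44)] -/
theorem dist_le' (h : BerindeUniquenessCondition T θ L₁) (x y : X) :
    dist (T x) (T y) ≤ θ * dist x y + L₁ * dist y (T y) := by
  rw [dist_comm (T x), dist_comm x y]
  exact h.dist_le y x

/-- Theorem 2.12 (1), first half: under (42) `T` has at most one fixed point.
[cite: Berinde2007, Ch. 2 Thm 2.12 (1)] -/
theorem fixedPoint_unique (h : BerindeUniquenessCondition T θ L₁) {p q : X} (hp : T p = p)
    (hq : T q = q) : p = q := by
  have h1 := h.dist_le p q
  rw [hp, hq, dist_self, mul_zero, add_zero] at h1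
  have h3 : dist p q ≤ 0 := by
    by_contra hne
    have hpos : 0 < dist p q := lt_of_not_ge hne
    nlinarith [h1, mul_pos (sub_pos.2 h.lt_one) hpos]
  exact dist_le_zero.1 h3

/-- (43): `d(xₙ₊₁, x*) ≤ θ d(xₙ, x*)` along any Picard sequence, for a fixed point `x*`.
[cite: Berinde2007, Ch. 2 Thm 2.12 (43)] -/
theorem orbit_dist_succ_fixedPoint_le (h : BerindeUniquenessCondition T θ L₁) {x : ℕ → X}
    (hx : ∀ n, x (n + 1) = T (x n)) {p : X} (hp : T p = p) (n : ℕ) :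
    dist (x (n + 1)) p ≤ θ * dist (x n) p := by
  have h1 := h.dist_le p (x n)
  rw [hp, dist_self, mul_zero, add_zero, ← hx n] at h1
  rwa [dist_comm, dist_comm (x n)]

/-- (43) for `xₙ = Tⁿ x₀`.
[cite: Berinde2007, Ch. 2 Thm 2.12 (43)] -/
theorem dist_iterate_succ_fixedPoint_le (h : BerindeUniquenessCondition T θ L₁) (x₀ : X) {p : X}
    (hp : T p = p) (n : ℕ) : dist (T^[n + 1] x₀) p ≤ θ * dist (T^[n] x₀) p :=
  h.orbit_dist_succ_fixedPoint_le (x := fun n => T^[n] x₀)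
    (IsAlmostContraction.picard_iterate_succ T x₀) hp n

/-- Under (42) every Picard sequence converges to any fixed point (by (43), since `θ < 1`);
no completeness is needed here.
[cite: Berinde2007, Ch. 2 Thm 2.12 (2), (43)] -/
theorem tendsto_orbit_fixedPoint (h : BerindeUniquenessCondition T θ L₁) {x : ℕ → X}
    (hx : ∀ n, x (n + 1) = T (x n)) {p : X} (hp : T p = p) : Tendsto x atTop (𝓝 p) := by
  have hgeom : ∀ n, dist (x n) p ≤ dist (x 0) p * θ ^ n := by
    intro n
    induction n with
    | zero => simp
    | succ n ih =>
      calc dist (x (n + 1)) p ≤ θ * dist (x n) p := h.orbit_dist_succ_fixedPoint_le hx hp n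
        _ ≤ θ * (dist (x 0) p * θ ^ n) := mul_le_mul_of_nonneg_left ih h.nonneg
        _ = dist (x 0) p * θ ^ (n + 1) := by ring
  have h0 : Tendsto (fun n => dist (x 0) p * θ ^ n) atTop (𝓝 (dist (x 0) p * 0)) :=
    (tendsto_pow_atTop_nhds_zero_of_lt_one h.nonneg h.lt_one).const_mul _
  rw [mul_zero] at h0
  rw [tendsto_iff_dist_tendsto_zero]
  exact squeeze_zero (fun n => dist_nonneg) hgeom h0

/-- Theorem 2.12 (2): under (42), the Picard iteration from any starting point converges to any
fixed point `p` (which is then unique); completeness is not needed for this step.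
[cite: Berinde2007, Ch. 2 Thm 2.12 (2)] -/
theorem tendsto_iterate_fixedPoint (h : BerindeUniquenessCondition T θ L₁) {p : X} (hp : T p = p)
    (x₀ : X) : Tendsto (fun n => T^[n] x₀) atTop (𝓝 p) :=
  h.tendsto_orbit_fixedPoint (IsAlmostContraction.picard_iterate_succ T x₀) hp

end BerindeUniquenessCondition

namespace IsAlmostContraction

variable {T : X → X} {δ L θ L₁ : ℝ}

/-- Theorem 2.12 (1): a weak contraction satisfying (42) on a nonempty complete metric space has
exactly one fixed point.
[cite: Berinde2007, Ch. 2 Thm 2.12 (1)] -/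
theorem existsUnique_fixedPoint [CompleteSpace X] [Nonempty X] (h : IsAlmostContraction T δ L)
    (hu : BerindeUniquenessCondition T θ L₁) : ∃! p : X, T p = p := by
  obtain ⟨p, hp⟩ := h.exists_fixedPoint
  exact ⟨p, hp, fun q hq => hu.fixedPoint_unique hq hp⟩

/-- Theorem 2.12 (3), a priori form: `d(Tⁿ x₀, p) ≤ d(x₀, T x₀) δⁿ / (1 - δ)` for the unique
fixed point `p`.
[cite: Berinde2007, Ch. 2 Thm 2.12 (3)] -/
theorem dist_iterate_fixedPoint_le_apriori (h : IsAlmostContraction T δ L)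
    (hu : BerindeUniquenessCondition T θ L₁) {p : X} (hp : T p = p) (x₀ : X) (n : ℕ) :
    dist (T^[n] x₀) p ≤ dist x₀ (T x₀) * δ ^ n / (1 - δ) :=
  h.dist_iterate_limit_le_apriori x₀ (hu.tendsto_iterate_fixedPoint hp x₀) n

/-- Theorem 2.12 (3), a posteriori form: `d(Tⁿ⁺¹ x₀, p) ≤ δ/(1 - δ) · d(Tⁿ x₀, Tⁿ⁺¹ x₀)`.
[cite: Berinde2007, Ch. 2 Thm 2.12 (3)] -/
theorem dist_iterate_fixedPoint_le_aposteriori (h : IsAlmostContraction T δ L)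
    (hu : BerindeUniquenessCondition T θ L₁) {p : X} (hp : T p = p) (x₀ : X) (n : ℕ) :
    dist (T^[n + 1] x₀) p ≤ δ / (1 - δ) * dist (T^[n] x₀) (T^[n + 1] x₀) :=
  h.dist_iterate_limit_le_aposteriori x₀ (hu.tendsto_iterate_fixedPoint hp x₀) n

end IsAlmostContraction

/-! ## An algebraic lemma used for Kannan, Chatterjea and Zamfirescu mappings -/

/-- If `(1 - b) D ≤ b (2A + B)` with `b ∈ [0, 1)`, `A, B ≥ 0` and `b/(1 - b) ≤ δ`, then
`D ≤ δ B + 2δ A`. [folklore] -/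
private theorem le_of_one_sub_mul_le {b δ A B D : ℝ} (hb1 : b < 1) (hδ : b / (1 - b) ≤ δ)
    (hA : 0 ≤ A) (hB : 0 ≤ B) (h : (1 - b) * D ≤ b * (2 * A + B)) :
    D ≤ δ * B + 2 * δ * A := by
  have hb' : 0 < 1 - b := sub_pos.2 hb1
  have hbδ : b ≤ δ * (1 - b) := (div_le_iff₀ hb').1 hδ
  have key : (1 - b) * D ≤ (1 - b) * (δ * B + 2 * δ * A) :=
    calc (1 - b) * D ≤ b * (2 * A + B) := h
      _ ≤ δ * (1 - b) * (2 * A + B) := mul_le_mul_of_nonneg_right hbδ (by positivity)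
      _ = (1 - b) * (δ * B + 2 * δ * A) := by ring
  exact le_of_mul_le_mul_left key hb'

/-! ## Kannan mappings (8), Proposition 2.2, Theorem 2.3 and Corollary 2.3 -/

/-- Kannan's contractive condition (8): `d(Tx, Ty) ≤ a [d(x, Tx) + d(y, Ty)]`, `a ∈ [0, 1/2)`.
[cite: Berinde2007, Ch. 2 Thm 2.3 (8)] -/
structure IsKannanMapping (T : X → X) (a : ℝ) : Prop where
  nonneg : 0 ≤ a
  lt_half : a < 1 / 2
  dist_le : ∀ x y, dist (T x) (T y) ≤ a * (dist x (T x) + dist y (T y))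

namespace IsKannanMapping

variable {T : X → X} {a : ℝ}

/-- `a < 1`. [cite: Berinde2007, Ch. 2 Thm 2.3 (8)] -/
theorem lt_one (h : IsKannanMapping T a) : a < 1 := by linarith [h.lt_half]

/-- `0 ≤ α = a/(1 - a)`. [cite: Berinde2007, Ch. 2 Thm 2.3 (9)] -/
theorem ratio_nonneg (h : IsKannanMapping T a) : 0 ≤ a / (1 - a) :=
  div_nonneg h.nonneg (sub_pos.2 h.lt_one).le

/-- `α = a/(1 - a) < 1` since `a < 1/2`. [cite: Berinde2007, Ch. 2 Thm 2.3 (9)] -/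
theorem ratio_lt_one (h : IsKannanMapping T a) : a / (1 - a) < 1 := by
  rw [div_lt_one (sub_pos.2 h.lt_one)]
  linarith [h.lt_half]

/-- Proposition 2.2: a Kannan mapping is a weak contraction with `δ = a/(1 - a)` and
`L = 2a/(1 - a)`.
[cite: Berinde2007, Ch. 2 Prop 2.2] -/
theorem isAlmostContraction (h : IsKannanMapping T a) :
    IsAlmostContraction T (a / (1 - a)) (2 * (a / (1 - a))) where
  nonneg := h.ratio_nonneg
  lt_one := h.ratio_lt_one
  coeff_nonneg := mul_nonneg zero_le_two h.ratio_nonneg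
  dist_le x y := by
    -- `d(x, Tx) ≤ d(x, y) + d(y, Tx)` and `d(y, Ty) ≤ d(y, Tx) + d(Tx, Ty)`
    have h1 := h.dist_le x y
    have h2 : dist x (T x) ≤ dist x y + dist y (T x) := dist_triangle _ _ _
    have h3 : dist y (T y) ≤ dist y (T x) + dist (T x) (T y) := dist_triangle _ _ _
    have h4 : (1 - a) * dist (T x) (T y) ≤ a * (2 * dist y (T x) + dist x y) := by
      nlinarith [h1, h2, h3, h.nonneg]
    have := le_of_one_sub_mul_le h.lt_one le_rfl dist_nonneg dist_nonneg h4
    linarith [this]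

/-- Remark 4 after Theorem 2.12: a Kannan mapping satisfies the uniqueness condition (42) with
`θ = a/(1 - a)` and `L₁ = 2a/(1 - a)`.
[cite: Berinde2007, Ch. 2 Thm 2.12 Remark 4] -/
theorem berindeUniquenessCondition (h : IsKannanMapping T a) :
    BerindeUniquenessCondition T (a / (1 - a)) (2 * (a / (1 - a))) where
  nonneg := h.ratio_nonneg
  lt_one := h.ratio_lt_one
  coeff_nonneg := mul_nonneg zero_le_two h.ratio_nonneg
  dist_le x y := by
    -- `d(y, Ty) ≤ d(y, x) + d(x, Tx) + d(Tx, Ty)`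
    have h1 := h.dist_le x y
    have h3 : dist y (T y) ≤ dist y x + dist x (T x) + dist (T x) (T y) := dist_triangle4 _ _ _ _
    rw [dist_comm y x] at h3
    have h4 : (1 - a) * dist (T x) (T y) ≤ a * (2 * dist x (T x) + dist x y) := by
      nlinarith [h1, h3, h.nonneg]
    have := le_of_one_sub_mul_le h.lt_one le_rfl dist_nonneg dist_nonneg h4
    linarith [this]

/-- Theorem 2.3 (Kannan): a Kannan mapping on a nonempty complete metric space has exactly one
fixed point.
[cite: Berinde2007, Ch. 2 Thm 2.3] -/
theorem existsUnique_fixedPoint [CompleteSpace X] [Nonempty X] (h : IsKannanMapping T a) :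
    ∃! p : X, T p = p :=
  h.isAlmostContraction.existsUnique_fixedPoint h.berindeUniquenessCondition

/-- Theorem 2.3 (Kannan): the Picard iteration converges to the fixed point from every starting
point (`T` is a Picard operator).
[cite: Berinde2007, Ch. 2 Thm 2.3] -/
theorem tendsto_iterate_fixedPoint (h : IsKannanMapping T a) {p : X} (hp : T p = p) (x₀ : X) :
    Tendsto (fun n => T^[n] x₀) atTop (𝓝 p) :=
  h.berindeUniquenessCondition.tendsto_iterate_fixedPoint hp x₀

/-- Corollary 2.3 (11): `d(xₙ, x*) ≤ αⁿ/(1 - α) d(x₀, x₁)` with `α = a/(1 - a)`.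
[cite: Berinde2007, Ch. 2 Cor 2.3 (11)] -/
theorem dist_iterate_fixedPoint_le_apriori (h : IsKannanMapping T a) {p : X} (hp : T p = p)
    (x₀ : X) (n : ℕ) :
    dist (T^[n] x₀) p ≤ dist x₀ (T x₀) * (a / (1 - a)) ^ n / (1 - a / (1 - a)) :=
  h.isAlmostContraction.dist_iterate_fixedPoint_le_apriori h.berindeUniquenessCondition hp x₀ n

/-- Corollary 2.3 (12): `d(xₙ₊₁, x*) ≤ α/(1 - α) d(xₙ, xₙ₊₁)` with `α = a/(1 - a)`.
[cite: Berinde2007, Ch. 2 Cor 2.3 (12)] -/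
theorem dist_iterate_fixedPoint_le_aposteriori (h : IsKannanMapping T a) {p : X} (hp : T p = p)
    (x₀ : X) (n : ℕ) :
    dist (T^[n + 1] x₀) p ≤
      a / (1 - a) / (1 - a / (1 - a)) * dist (T^[n] x₀) (T^[n + 1] x₀) :=
  h.isAlmostContraction.dist_iterate_fixedPoint_le_aposteriori h.berindeUniquenessCondition hp x₀ n

end IsKannanMapping

/-! ## Chatterjea mappings (34) and Proposition 2.3 -/

/-- Chatterjea's contractive condition (34): `d(Tx, Ty) ≤ c [d(x, Ty) + d(y, Tx)]`,
`c ∈ [0, 1/2)`.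
[cite: Berinde2007, Ch. 2 Prop 2.3 (34)] -/
structure IsChatterjeaMapping (T : X → X) (c : ℝ) : Prop where
  nonneg : 0 ≤ c
  lt_half : c < 1 / 2
  dist_le : ∀ x y, dist (T x) (T y) ≤ c * (dist x (T y) + dist y (T x))

namespace IsChatterjeaMapping

variable {T : X → X} {c : ℝ}

/-- `c < 1`. [cite: Berinde2007, Ch. 2 Prop 2.3 (34)] -/
theorem lt_one (h : IsChatterjeaMapping T c) : c < 1 := by linarith [h.lt_half]

/-- `0 ≤ c/(1 - c)`. [cite: Berinde2007, Ch. 2 Prop 2.3] -/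
theorem ratio_nonneg (h : IsChatterjeaMapping T c) : 0 ≤ c / (1 - c) :=
  div_nonneg h.nonneg (sub_pos.2 h.lt_one).le

/-- `c/(1 - c) < 1` since `c < 1/2`. [cite: Berinde2007, Ch. 2 Prop 2.3] -/
theorem ratio_lt_one (h : IsChatterjeaMapping T c) : c / (1 - c) < 1 := by
  rw [div_lt_one (sub_pos.2 h.lt_one)]
  linarith [h.lt_half]

/-- Proposition 2.3: a Chatterjea mapping is a weak contraction with `δ = c/(1 - c)` and
`L = 2c/(1 - c)`.
[cite: Berinde2007, Ch. 2 Prop 2.3] -/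
theorem isAlmostContraction (h : IsChatterjeaMapping T c) :
    IsAlmostContraction T (c / (1 - c)) (2 * (c / (1 - c))) where
  nonneg := h.ratio_nonneg
  lt_one := h.ratio_lt_one
  coeff_nonneg := mul_nonneg zero_le_two h.ratio_nonneg
  dist_le x y := by
    -- `d(x, Ty) ≤ d(x, y) + d(y, Tx) + d(Tx, Ty)`
    have h1 := h.dist_le x y
    have h2 : dist x (T y) ≤ dist x y + dist y (T x) + dist (T x) (T y) := dist_triangle4 _ _ _ _
    have h4 : (1 - c) * dist (T x) (T y) ≤ c * (2 * dist y (T x) + dist x y) := by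
      nlinarith [h1, h2, h.nonneg]
    have := le_of_one_sub_mul_le h.lt_one le_rfl dist_nonneg dist_nonneg h4
    linarith [this]

/-- Remark 4 after Theorem 2.12: a Chatterjea mapping satisfies (42) with `θ = c/(1 - c)` and
`L₁ = 2c/(1 - c)`.
[cite: Berinde2007, Ch. 2 Thm 2.12 Remark 4] -/
theorem berindeUniquenessCondition (h : IsChatterjeaMapping T c) :
    BerindeUniquenessCondition T (c / (1 - c)) (2 * (c / (1 - c))) where
  nonneg := h.ratio_nonneg
  lt_one := h.ratio_lt_one
  coeff_nonneg := mul_nonneg zero_le_two h.ratio_nonneg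
  dist_le x y := by
    -- `d(x, Ty) ≤ d(x, Tx) + d(Tx, Ty)` and `d(y, Tx) ≤ d(y, x) + d(x, Tx)`
    have h1 := h.dist_le x y
    have h2 : dist x (T y) ≤ dist x (T x) + dist (T x) (T y) := dist_triangle _ _ _
    have h3 : dist y (T x) ≤ dist y x + dist x (T x) := dist_triangle _ _ _
    rw [dist_comm y x] at h3
    have h4 : (1 - c) * dist (T x) (T y) ≤ c * (2 * dist x (T x) + dist x y) := by
      nlinarith [h1, h2, h3, h.nonneg]
    have := le_of_one_sub_mul_le h.lt_one le_rfl dist_nonneg dist_nonneg h4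
    linarith [this]

/-- Chatterjea's fixed point theorem (via Theorem 2.12): a Chatterjea mapping on a nonempty
complete metric space has exactly one fixed point.
[cite: Berinde2007, Ch. 2 Thm 2.12 Remark 4] -/
theorem existsUnique_fixedPoint [CompleteSpace X] [Nonempty X] (h : IsChatterjeaMapping T c) :
    ∃! p : X, T p = p :=
  h.isAlmostContraction.existsUnique_fixedPoint h.berindeUniquenessCondition

/-- The Picard iteration of a Chatterjea mapping converges to its fixed point.
[cite: Berinde2007, Ch. 2 Thm 2.12 Remark 4] -/
theorem tendsto_iterate_fixedPoint (h : IsChatterjeaMapping T c) {p : X} (hp : T p = p)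
    (x₀ : X) : Tendsto (fun n => T^[n] x₀) atTop (𝓝 p) :=
  h.berindeUniquenessCondition.tendsto_iterate_fixedPoint hp x₀

end IsChatterjeaMapping

/-! ## Zamfirescu mappings, (15), (16), Corollary 2.5 and Theorem 2.4 -/

/-- Zamfirescu's condition: `α ∈ [0, 1)`, `β, γ ∈ [0, 1/2)` and for every `x, y` at least one of
(z₁) `d(Tx, Ty) ≤ α d(x, y)`, (z₂) `d(Tx, Ty) ≤ β [d(x, Tx) + d(y, Ty)]`,
(z₃) `d(Tx, Ty) ≤ γ [d(x, Ty) + d(y, Tx)]`.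
[cite: Berinde2007, Ch. 2 Thm 2.4 (z₁)–(z₃)] -/
structure IsZamfirescuMapping (T : X → X) (α β γ : ℝ) : Prop where
  α_nonneg : 0 ≤ α
  α_lt_one : α < 1
  β_nonneg : 0 ≤ β
  β_lt_half : β < 1 / 2
  γ_nonneg : 0 ≤ γ
  γ_lt_half : γ < 1 / 2
  dist_le : ∀ x y, dist (T x) (T y) ≤ α * dist x y ∨
    dist (T x) (T y) ≤ β * (dist x (T x) + dist y (T y)) ∨
    dist (T x) (T y) ≤ γ * (dist x (T y) + dist y (T x))

namespace IsZamfirescuMapping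

variable {T : X → X} {α β γ : ℝ}

/-- Zamfirescu's constant `δ = max {α, β/(1 - β), γ/(1 - γ)}`.
[cite: Berinde2007, Ch. 2 Thm 2.4 (proof)] -/
noncomputable def delta (_ : IsZamfirescuMapping T α β γ) : ℝ :=
  max α (max (β / (1 - β)) (γ / (1 - γ)))

/-- `0 ≤ δ`. [cite: Berinde2007, Ch. 2 Thm 2.4 (proof)] -/
theorem delta_nonneg (h : IsZamfirescuMapping T α β γ) : 0 ≤ h.delta :=
  le_max_of_le_left h.α_nonneg

/-- `0 ≤ δ < 1`.
[cite: Berinde2007, Ch. 2 Thm 2.4 (proof)] -/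
theorem delta_lt_one (h : IsZamfirescuMapping T α β γ) : h.delta < 1 := by
  have hβ : β / (1 - β) < 1 := by
    rw [div_lt_one (by linarith [h.β_lt_half])]; linarith [h.β_lt_half]
  have hγ : γ / (1 - γ) < 1 := by
    rw [div_lt_one (by linarith [h.γ_lt_half])]; linarith [h.γ_lt_half]
  exact max_lt h.α_lt_one (max_lt hβ hγ)

/-- `α ≤ δ`. [cite: Berinde2007, Ch. 2 Thm 2.4 (proof)] -/
theorem le_delta_α (h : IsZamfirescuMapping T α β γ) : α ≤ h.delta := le_max_left _ _

/-- `β/(1 - β) ≤ δ`. [cite: Berinde2007, Ch. 2 Thm 2.4 (proof)] -/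
theorem le_delta_β (h : IsZamfirescuMapping T α β γ) : β / (1 - β) ≤ h.delta :=
  le_max_of_le_right (le_max_left _ _)

/-- `γ/(1 - γ) ≤ δ`. [cite: Berinde2007, Ch. 2 Thm 2.4 (proof)] -/
theorem le_delta_γ (h : IsZamfirescuMapping T α β γ) : γ / (1 - γ) ≤ h.delta :=
  le_max_of_le_right (le_max_right _ _)

/-- (15): `d(Tx, Ty) ≤ 2δ d(x, Tx) + δ d(x, y)`.
[cite: Berinde2007, Ch. 2 Thm 2.4 (15)] -/
theorem dist_le_fifteen (h : IsZamfirescuMapping T α β γ) (x y : X) :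
    dist (T x) (T y) ≤ 2 * h.delta * dist x (T x) + h.delta * dist x y := by
  have hδ := h.delta_nonneg
  rcases h.dist_le x y with h1 | h1 | h1
  · -- (z₁)
    have : α * dist x y ≤ h.delta * dist x y := mul_le_mul_of_nonneg_right h.le_delta_α dist_nonneg
    nlinarith [this, h1, mul_nonneg hδ (dist_nonneg (x := x) (y := T x))]
  · -- (z₂): `d(y, Ty) ≤ d(y, x) + d(x, Tx) + d(Tx, Ty)` gives (13)
    have h3 : dist y (T y) ≤ dist y x + dist x (T x) + dist (T x) (T y) := dist_triangle4 _ _ _ _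
    rw [dist_comm y x] at h3
    have h4 : (1 - β) * dist (T x) (T y) ≤ β * (2 * dist x (T x) + dist x y) := by
      nlinarith [h1, h3, h.β_nonneg]
    have := le_of_one_sub_mul_le (by linarith [h.β_lt_half]) h.le_delta_β dist_nonneg
      dist_nonneg h4
    linarith [this]
  · -- (z₃): `d(x, Ty) ≤ d(x, Tx) + d(Tx, Ty)`, `d(y, Tx) ≤ d(y, x) + d(x, Tx)` gives (14)
    have h2 : dist x (T y) ≤ dist x (T x) + dist (T x) (T y) := dist_triangle _ _ _
    have h3 : dist y (T x) ≤ dist y x + dist x (T x) := dist_triangle _ _ _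
    rw [dist_comm y x] at h3
    have h4 : (1 - γ) * dist (T x) (T y) ≤ γ * (2 * dist x (T x) + dist x y) := by
      nlinarith [h1, h2, h3, h.γ_nonneg]
    have := le_of_one_sub_mul_le (by linarith [h.γ_lt_half]) h.le_delta_γ dist_nonneg
      dist_nonneg h4
    linarith [this]

/-- (16): `d(Tx, Ty) ≤ 2δ d(x, Ty) + δ d(x, y)`.
[cite: Berinde2007, Ch. 2 Thm 2.4 (16)] -/
theorem dist_le_sixteen (h : IsZamfirescuMapping T α β γ) (x y : X) :
    dist (T x) (T y) ≤ 2 * h.delta * dist x (T y) + h.delta * dist x y := by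
  have hδ := h.delta_nonneg
  rcases h.dist_le x y with h1 | h1 | h1
  · -- (z₁)
    have : α * dist x y ≤ h.delta * dist x y := mul_le_mul_of_nonneg_right h.le_delta_α dist_nonneg
    nlinarith [this, h1, mul_nonneg hδ (dist_nonneg (x := x) (y := T y))]
  · -- (z₂): `d(x, Tx) ≤ d(x, Ty) + d(Ty, Tx)`, `d(y, Ty) ≤ d(y, x) + d(x, Ty)`
    have h2 : dist x (T x) ≤ dist x (T y) + dist (T y) (T x) := dist_triangle _ _ _
    have h3 : dist y (T y) ≤ dist y x + dist x (T y) := dist_triangle _ _ _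
    rw [dist_comm y x] at h3
    rw [dist_comm (T y) (T x)] at h2
    have h4 : (1 - β) * dist (T x) (T y) ≤ β * (2 * dist x (T y) + dist x y) := by
      nlinarith [h1, h2, h3, h.β_nonneg]
    have := le_of_one_sub_mul_le (by linarith [h.β_lt_half]) h.le_delta_β dist_nonneg
      dist_nonneg h4
    linarith [this]
  · -- (z₃): `d(y, Tx) ≤ d(y, x) + d(x, Ty) + d(Ty, Tx)`
    have h3 : dist y (T x) ≤ dist y x + dist x (T y) + dist (T y) (T x) := dist_triangle4 _ _ _ _
    rw [dist_comm y x, dist_comm (T y) (T x)] at h3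
    have h4 : (1 - γ) * dist (T x) (T y) ≤ γ * (2 * dist x (T y) + dist x y) := by
      nlinarith [h1, h3, h.γ_nonneg]
    have := le_of_one_sub_mul_le (by linarith [h.γ_lt_half]) h.le_delta_γ dist_nonneg
      dist_nonneg h4
    linarith [this]

/-- Corollary 2.5: a Zamfirescu mapping is a weak contraction, with `δ` Zamfirescu's constant and
`L = 2δ` (from (16) with the roles of `x` and `y` exchanged).
[cite: Berinde2007, Ch. 2 Cor 2.5] -/
theorem isAlmostContraction (h : IsZamfirescuMapping T α β γ) :
    IsAlmostContraction T h.delta (2 * h.delta) where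
  nonneg := h.delta_nonneg
  lt_one := h.delta_lt_one
  coeff_nonneg := mul_nonneg zero_le_two h.delta_nonneg
  dist_le x y := by
    have := h.dist_le_sixteen y x
    rw [dist_comm (T y) (T x), dist_comm y x] at this
    linarith [this]

/-- Remark 4 after Theorem 2.12: a Zamfirescu mapping satisfies (42) with `θ = δ`, `L₁ = 2δ`
(this is (15)).
[cite: Berinde2007, Ch. 2 Thm 2.12 Remark 4] -/
theorem berindeUniquenessCondition (h : IsZamfirescuMapping T α β γ) :
    BerindeUniquenessCondition T h.delta (2 * h.delta) where
  nonneg := h.delta_nonneg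
  lt_one := h.delta_lt_one
  coeff_nonneg := mul_nonneg zero_le_two h.delta_nonneg
  dist_le x y := by linarith [h.dist_le_fifteen x y]

/-- Theorem 2.4 (Zamfirescu): a Zamfirescu mapping on a nonempty complete metric space has
exactly one fixed point.
[cite: Berinde2007, Ch. 2 Thm 2.4] -/
theorem existsUnique_fixedPoint [CompleteSpace X] [Nonempty X] (h : IsZamfirescuMapping T α β γ) :
    ∃! p : X, T p = p :=
  h.isAlmostContraction.existsUnique_fixedPoint h.berindeUniquenessCondition

/-- Theorem 2.4 (Zamfirescu): the Picard iteration converges to the fixed point from every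
starting point.
[cite: Berinde2007, Ch. 2 Thm 2.4] -/
theorem tendsto_iterate_fixedPoint (h : IsZamfirescuMapping T α β γ) {p : X} (hp : T p = p)
    (x₀ : X) : Tendsto (fun n => T^[n] x₀) atTop (𝓝 p) :=
  h.berindeUniquenessCondition.tendsto_iterate_fixedPoint hp x₀

/-- Remark 1 after Theorem 2.4: the a priori estimate (11) with Zamfirescu's `δ` in place of `α`,
`d(xₙ, x*) ≤ δⁿ/(1 - δ) d(x₀, x₁)`.
[cite: Berinde2007, Ch. 2 Thm 2.4 Remark 1] -/
theorem dist_iterate_fixedPoint_le_apriori (h : IsZamfirescuMapping T α β γ) {p : X}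
    (hp : T p = p) (x₀ : X) (n : ℕ) :
    dist (T^[n] x₀) p ≤ dist x₀ (T x₀) * h.delta ^ n / (1 - h.delta) :=
  h.isAlmostContraction.dist_iterate_fixedPoint_le_apriori h.berindeUniquenessCondition hp x₀ n

/-- Remark 1 after Theorem 2.4: the a posteriori estimate (12) with Zamfirescu's `δ`,
`d(xₙ₊₁, x*) ≤ δ/(1 - δ) d(xₙ, xₙ₊₁)`.
[cite: Berinde2007, Ch. 2 Thm 2.4 Remark 1] -/
theorem dist_iterate_fixedPoint_le_aposteriori (h : IsZamfirescuMapping T α β γ) {p : X}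
    (hp : T p = p) (x₀ : X) (n : ℕ) :
    dist (T^[n + 1] x₀) p ≤ h.delta / (1 - h.delta) * dist (T^[n] x₀) (T^[n + 1] x₀) :=
  h.isAlmostContraction.dist_iterate_fixedPoint_le_aposteriori h.berindeUniquenessCondition hp x₀ n

/-- Example 2.5: a Zamfirescu mapping is strictly quasi-nonexpansive, `d(Tx, p) ≤ δ d(x, p)` for
a fixed point `p`.
[cite: Berinde2007, Ch. 2 Example 2.5] -/
theorem dist_map_fixedPoint_le (h : IsZamfirescuMapping T α β γ) {p : X} (hp : T p = p)
    (x : X) : dist (T x) p ≤ h.delta * dist x p := by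
  have h1 := h.dist_le_fifteen p x
  rw [hp, dist_self, mul_zero, zero_add] at h1
  rwa [dist_comm, dist_comm x]

end IsZamfirescuMapping

/-- Example 2.5: a Kannan mapping is strictly quasi-nonexpansive,
`d(Tx, p) ≤ a/(1 - a) · d(x, p)` for a fixed point `p`.
[cite: Berinde2007, Ch. 2 Example 2.5] -/
theorem IsKannanMapping.dist_map_fixedPoint_le {T : X → X} {a : ℝ} (h : IsKannanMapping T a)
    {p : X} (hp : T p = p) (x : X) : dist (T x) p ≤ a / (1 - a) * dist x p := by
  have h1 := h.berindeUniquenessCondition.dist_le p x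
  rw [hp, dist_self, mul_zero, add_zero] at h1
  rwa [dist_comm, dist_comm x]

end Literature.Analysis.Convex.AlmostContractions
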